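import Literature.Analysis.FluidPDE.FractionalNSPrescribedEnergyFamilies
import Literature.Analysis.FluidPDE.FractionalNSReynolds
import Literature.Analysis.FluidPDE.OnsagerBDSV
import HarnessLib

/-!
# The convex-integration iteration behind Colombo–De Lellis–De Rosa 2018, Prop. 2.2
# (their Prop. 3.2 with Lemma 3.1, run with universal parameters as in §8.3) — named fact

Analysis/FluidPDE facts file, sibling of `FractionalNSPrescribedEnergyFamilies.lean` (which
vendors Prop. 2.2 of the source as the named fact `ColomboDeLellisDeRosa2018_prop22`) and of
`DeRosaScheme.lean` (the same service for De Rosa 2019, Thm. 2.1). The source proves Prop. 2.2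
(§8.3, pp. 18–19 of the held arXiv text) in two steps:

1. **The iteration** (this file, `ColomboDeLellisDeRosa2018_prop32`, a NAMED FACT). Prop. 3.2
   (§3.2, p. 7): there are constants `M ≥ 1`, `η > 0`, `C₀` such that for `α < 1/5`, `c > 5/2`,
   `b > 1` and `a ≥ max{a₀(b,c), C₀‖e‖_{C¹}, C₀‖e‖_{C²}^{1/((2c-1)b-1)}}` (display (41), cf. (36))
   there is a sequence of smooth triples `(v_q, p_q, R̊_q)` on `𝕋³ × [0,1]`, starting with the
   explicit triple of Lemma 3.1 (§3.1), solving the fractional Navier–Stokes–Reynolds system (26)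
   `∂ₜv_q + div(v_q⊗v_q) + ∇p_q + (-Δ)^α v_q = div R̊_q`, `div v_q = 0`, and obeying the
   estimates (27)–(33) with `δ_q = a^{-b^q}`, `λ_q ∈ ℕ ∩ [a^{cb^{q+1}}, 2a^{cb^{q+1}}]` (34),
   together with the energy estimate (35) `|e(t)(1-δ_{q+1}) - ∫|v_q|²(x,t)dx| ≤ ¼ δ_{q+1} e(t)`
   which the scheme propagates (§3, p. 6: "the equation (7) will be ensured by (35)"; §6
   Lemma 6.1; §8.2 "Estimate on the energy"). §8.3 runs this iteration "universally" over a
   family `𝓔` of profiles with `sup‖e‖_{C¹} ≤ E₁`, `sup‖e‖_{C²} ≤ E₂`: "it suffices to notice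
   that we just need to replace the `‖e‖_{C¹}` and `‖e‖_{C²}` in (36) with `E₁` and `E₂`"
   (display (81)), with the starting triple of Lemma 3.1 built from
   `λ̄ = C₀ max{a^{b/(1-2α)}, E₁a^b, E₂a^{-(c-1)b+1/2}}` (82), so that — `e(0)` and `e'(0)` being
   common to the family — "each `v_{e,q+1}(·,0)` and `R̊_{e,q+1}(·,0)` depend only upon the
   `v_{q,e}(·,0)`, `R̊_{q,e}(·,0)` and `e(0)`, hence … such values are also independent of the
   chosen `e ∈ 𝓔`", and "the argument of Lemma 3.1 gives the corresponding estimate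
   `‖v_0‖_{C¹} ≤ max{a^{b/(1-2α)}, a^bE₁, E₂^{(cb-1/2)/((2c-1)b-1)}}`". This is the
   research-level core of the paper (§§4–8: Beltrami flows, the geometric lemma, mollification,
   CFL time discretisation and transport of the stress, the inverse-divergence operator `ℛ`,
   Schauder and commutator estimates for `(-Δ)^α`, stationary phase); it stays a named fact.
2. **The limit** `q → ∞` (proof of Thm. 2.1, §3.2 p. 8, and the second half of §8.3): uniform
   convergence of `v_{e,q}` by (27), weak solution in the limit since `R̊_q → 0` by (31), the
   energy identity from (35), the Hölder bound (13) by interpolation between (27) and (28) plus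
   the bookkeeping of exponents as `(ε, c, b) → (0, 5/2, 1)`, and the common datum. This step is
   PROVED in the tree (`ColomboDeLellisDeRosa2018_prop22_of_prop32`,
   `FractionalNSPrescribedEnergyFamiliesProofs.lean`), reducing Prop. 2.2 to the present fact.

## Normalisation and rendering (every deviation weakens the printed statement)

* Units: as in `FractionalNSPrescribedEnergyFamilies` (read its header) the tree's torus is the
  unit torus `(ℝ/ℤ)³` with probability measure and symbol `(2π|k|)^{2α}`; the printed `[0,1]`,
  `½ ≤ e ≤ 1` become a window `[0,T₀]`, `c₀/2 ≤ e ≤ c₀` for SOME `c₀, T₀ > 0` depending on `α`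
  (the dictionary `u(y,s) = λv(2πy, μs)`, `p ↦ λ²p`, `R̊ ↦ λ²R̊` multiplies sup norms by `λ`
  (`λ²`), first spatial derivatives by `2πλ`, energies by `c₀`; the system keeps viscosity `1`
  and (35) is homogeneous). Hence `∃ c₀ T₀` right after `α`, and the constants `M, η, C₀` are
  allowed to depend on `α` (printed: absolute constants) — weaker; `M ≥ 1` as printed, `C₀ ≥ 1`
  and `a₀ > 1` without loss (enlarging `C₀`, `a₀` or `η` only weakens the statement).
* Hypotheses (iv)–(v) on the family are those of `IsEnergyProfileFamily c₀ T₀ E₁ E₂ 𝓔`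
  (bounds `|e'| ≤ c₀E₁/T₀`, `|e''| ≤ c₀E₂/T₀²`, parameters `1 < E₁ ≤ E₂`, see that structure's
  docstring: a printed profile then has `‖e‖_{C¹} ≤ 2E₁`, `‖e‖_{C²} ≤ 3E₂`, the factors being
  absorbed into `C₀`).
* Parameters: `c > 5/2` arbitrary; `b` is restricted to `1 < b < b₁(α, c)` — the printed
  Prop. 3.2 allows every `b > 1`, but its proof (§8.2, p. 18: "evaluating the exponent in
  `b = 1`, we have that the last inequality holds (choosing `b` sufficiently near `1`)"; likewise
  "for `b` sufficiently near `1`" in the energy estimate) only yields `b` near `1`, and Prop. 2.2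
  only uses `(c, b) → (5/2, 1)`; `a₀` may depend on `α, b, c` (printed `a₀(b,c)`); any
  `a ≥ max{a₀, C₀E₁, C₀E₂^{1/((2c-1)b-1)}}` is allowed (Prop. 3.2 (41); §8.3 takes equality (81)).
* Norms are the tree's BDSV bound predicates (`OnsagerBDSV`; the source's §10 conventions are
  BDSV's App. A: `‖f‖₀ = sup_{𝕋³×[0,1]}|f|`, `[f]₁ = max_{|β|=1}‖D^βf‖₀` with spatial derivatives
  only, `‖f‖₁ = ‖f‖₀ + [f]₁`): `BDSV.SupLE T₀ f B` for `‖f‖₀ ≤ B` and `BDSV.DerivSupLE T₀ f B`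
  for `[f]₁ ≤ B` (partial derivatives `Torus.partialDeriv` along the unit coordinate vectors of
  the unit torus; the factor `2πλ` of the dictionary goes into `M`, `C₀`). The `C¹` bounds (28)
  `‖v_{q+1}-v_q‖₁ ≤ Mδ_{q+1}^{1/2}λ_{q+1}` and `‖v_{e,0}‖_{C¹} ≤ …` are transcribed through their
  consequence `[·]₁ ≤ …` (weaker); the stress is stored by columns with the pointwise norm of
  `Torus.IsEulerReynoldsOn` (all matrix norms are equivalent; constants into `η`).
* "Solving (26)" is `Torus.IsFracNSReynoldsOn (Icc 0 T₀) α 1` (jointly smooth on the closed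
  slab, symmetric stress, viscosity `1`); the printed stress is moreover trace-free (dropped).
* Conclusions transcribed (`CDLDR.IsIterationSequence`): (26); (27); (28) and §8.3's
  `‖v_{e,0}‖_{C¹}` bound (as `[·]₁`-bounds, the latter with the constant `C₀` of Lemma 3.1 (38));
  (29); (31); (35); (37) `‖v_0‖₀ ≤ M`; the frequencies (34); and the common initial slice
  `v_{e,q}(·,0)` (§8.3). NOT transcribed (weaker): (30), (32), (33), (43), the common initial
  slice of `R̊_{e,q}`, tracelessness, and the case `α ∈ [1/5, 1/2[` (second bullet of Prop. 3.2).

## References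

* M. Colombo, C. De Lellis, L. De Rosa, *Ill-posedness of Leray solutions for the hypodissipative
  Navier–Stokes equations*, Comm. Math. Phys. 362 (2018), 659–688 (held: arXiv:1708.05666): §3
  (26)–(35), Lemma 3.1 with (36)–(40), Prop. 3.2 with (41)–(43) and the proof of Thm. 2.1 (pp.
  6–8); §8.2 (proof of Prop. 3.2, pp. 17–18); §8.3 (proof of Prop. 2.2, (81)–(82), pp. 18–19);
  §10 (Hölder norms, p. 21). [`ColomboDelellisDerosa2018`]
* T. Buckmaster, C. De Lellis, P. Isett, L. Székelyhidi Jr., *Anomalous dissipation for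
  `1/5`-Hölder Euler flows*, Ann. of Math. 182 (2015) (the scheme being adapted).
  [`BuckmasterEtAl2015`]
* T. Buckmaster, C. De Lellis, L. Székelyhidi Jr., V. Vicol, CPAM 72 (2019), App. A (the sup-norm
  conventions `BDSV.SupLE`, `BDSV.DerivSupLE`). [`BuckmasterEtAl2018`]
-/

noncomputable section

open MeasureTheory Set Filter Function
open scoped ENNReal NNReal

namespace Literature.Analysis.FluidPDE

section NS

/-- The flat three-torus `𝕋³ = (ℝ/ℤ)³`, local notation. -/
local notation "𝕋³" => UnitAddTorus (Fin 3)

/-- Euclidean `ℝ³`, local notation. -/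
local notation "ℝ³" => EuclideanSpace ℝ (Fin 3)

namespace CDLDR

/-! ## The amplitudes of the scheme -/

/-- The amplitudes `δ_q = a^{-b^q}` of the Colombo–De Lellis–De Rosa scheme (§3 (34):
"`δ_q = a^{-b^q}` and `λ_q ∈ ℕ ∩ [a^{cb^{q+1}}, 2a^{cb^{q+1}}]`"; contrast BDSV's
`δ_q = λ_q^{-2β}`, `BDSV.amp`). [cite: ColomboDelellisDerosa2018, §3 (34)] -/
def amp (a b : ℝ) (q : ℕ) : ℝ :=
  a ^ (-(b ^ q))

/-- Unfolding `CDLDR.amp`. [folklore] -/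
theorem amp_def (a b : ℝ) (q : ℕ) : amp a b q = a ^ (-(b ^ q)) := rfl

/-- The amplitudes are positive for `a > 0`. [folklore] -/
theorem amp_pos {a : ℝ} (ha : 0 < a) (b : ℝ) (q : ℕ) : 0 < amp a b q :=
  Real.rpow_pos_of_pos ha _

/-- The amplitudes are at most `1` for `a ≥ 1` and `b ≥ 0`. [folklore] -/
theorem amp_le_one {a b : ℝ} (ha : 1 ≤ a) (hb : 0 ≤ b) (q : ℕ) : amp a b q ≤ 1 :=
  Real.rpow_le_one_of_one_le_of_nonpos ha (neg_nonpos.2 (pow_nonneg hb q))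

/-! ## The output of the iteration for one profile -/

/-- **The sequence produced by the iteration for one energy profile `e`** (Colombo–De Lellis–
De Rosa 2018, Prop. 3.2 with Lemma 3.1, read in §8.3 with universal parameters): relative to
the exponent `α`, the window `[0,T₀]`, the constants `M, η`, the parameters `a, b`, a bound `L₀`
for `[v_0]₁` and integer frequencies `Λ`, the triples `(v_q, p_q, R_q)` satisfy
(26) each solves the fractional Navier–Stokes–Reynolds system classically on `[0,T₀] × 𝕋³`
(`Torus.IsFracNSReynoldsOn`, viscosity `1`); (27) `‖v_{q+1} - v_q‖₀ ≤ M δ_{q+1}^{1/2}`;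
(28) `[v_{q+1} - v_q]₁ ≤ M δ_{q+1}^{1/2} Λ_{q+1}`; (29) `‖p_{q+1} - p_q‖₀ ≤ M² δ_{q+1}`;
(31) `‖R_q‖₀ ≤ η δ_{q+1}`; (35) `|e(t)(1-δ_{q+1}) - ∫‖v_q(t)‖²| ≤ ¼ δ_{q+1} e(t)` on `[0,T₀]`;
(37) `‖v_0‖₀ ≤ M`; and `[v_0]₁ ≤ L₀` (§8.3), with `δ = CDLDR.amp a b` and the sup-norm predicates
`BDSV.SupLE`, `BDSV.DerivSupLE` on `[0,T₀] × 𝕋³`.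
[cite: ColomboDelellisDerosa2018, §3 (26)–(29), (31), (35), (37); §8.3] -/
structure IsIterationSequence (α T₀ M η a b L₀ : ℝ) (Λ : ℕ → ℕ) (e : ℝ → ℝ)
    (v : ℕ → ℝ → 𝕋³ → ℝ³) (p : ℕ → ℝ → 𝕋³ → ℝ) (R : ℕ → ℝ → 𝕋³ → Fin 3 → ℝ³) : Prop where
  /-- (26): every stage solves the fractional Navier–Stokes–Reynolds system on `[0,T₀] × 𝕋³`. -/
  isFracNSReynoldsOn : ∀ q, Torus.IsFracNSReynoldsOn (Icc 0 T₀) α 1 (v q) (p q) (R q)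
  /-- (27): `‖v_{q+1} - v_q‖₀ ≤ M δ_{q+1}^{1/2}`. -/
  velocity_sup : ∀ q, BDSV.SupLE T₀ (fun t x => v (q + 1) t x - v q t x) (M * Real.sqrt (amp a b (q + 1)))
  /-- (28): `[v_{q+1} - v_q]₁ ≤ M δ_{q+1}^{1/2} λ_{q+1}`. -/
  velocity_deriv : ∀ q, BDSV.DerivSupLE T₀ (fun t x => v (q + 1) t x - v q t x)
    (M * Real.sqrt (amp a b (q + 1)) * Λ (q + 1))
  /-- (29): `‖p_{q+1} - p_q‖₀ ≤ M² δ_{q+1}`. -/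
  pressure_sup : ∀ q, BDSV.SupLE T₀ (fun t x => p (q + 1) t x - p q t x) (M ^ 2 * amp a b (q + 1))
  /-- (31): `‖R̊_q‖₀ ≤ η δ_{q+1}`. -/
  stress_sup : ∀ q, BDSV.SupLE T₀ (R q) (η * amp a b (q + 1))
  /-- (35): `|e(t)(1 - δ_{q+1}) - ∫ ‖v_q(t)‖²| ≤ ¼ δ_{q+1} e(t)` on `[0,T₀]`. -/
  energy : ∀ q, ∀ t ∈ Icc 0 T₀,
    |e t * (1 - amp a b (q + 1)) - ∫ x, ‖v q t x‖ ^ 2| ≤ 1 / 4 * amp a b (q + 1) * e t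
  /-- (37): `‖v_0‖₀ ≤ M`. -/
  velocity_zero_sup : BDSV.SupLE T₀ (v 0) M
  /-- §8.3 (with Lemma 3.1 (38)): `[v_0]₁ ≤ L₀`. -/
  velocity_zero_deriv : BDSV.DerivSupLE T₀ (v 0) L₀

end CDLDR

/-! ## Colombo–De Lellis–De Rosa 2018, Prop. 3.2 (universal form of §8.3) -/

/-- **Colombo–De Lellis–De Rosa 2018, Prop. 3.2 with Lemma 3.1, run with universal parameters
over a family of energy profiles (§8.3)** — the convex-integration iteration from which their
Prop. 2.2 (`ColomboDeLellisDeRosa2018_prop22`) follows by passing to the limit. Printed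
(Prop. 3.2, first bullet): "There are positive constants `M ≥ 1`, `η > 0` and `C₀` such that the
following holds. Assume `α < 1/5` and `a, b` and `c` satisfy `c > 5/2`, `b > 1` and
`a ≥ max{a₀(b,c), C₀‖e‖_{C¹}, C₀‖e‖_{C²}^{1/((2c-1)b-1)}}`, where `a₀` depends only upon `b` and
`c`. Then there is a sequence `(v_q, p_q, R̊_q)` starting with the `(v_0, p_0, R̊_0)` of
Lemma 3.1, solving (26) and satisfying the estimates (27)–(33), where `δ_q` and `λ_q` are as in
(34)", with (27) `‖v_q - v_{q-1}‖₀ ≤ Mδ_q^{1/2}`, (28) `‖v_q - v_{q-1}‖₁ ≤ Mδ_q^{1/2}λ_q`,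
(29) `‖p_q - p_{q-1}‖₀ ≤ M²δ_q`, (31) `‖R̊_q‖₀ ≤ ηδ_{q+1}`, (34) `δ_q = a^{-b^q}`,
`λ_q ∈ ℕ ∩ [a^{cb^{q+1}}, 2a^{cb^{q+1}}]`, (35) `|e(t)(1-δ_{q+1}) - ∫|v_q|²(x,t)dx| ≤ ¼δ_{q+1}e(t)`,
(37) `‖v_0‖₀ ≤ M`; and (§8.3) for a family `𝓔` as in Prop. 2.2 the parameters are chosen
universally — `a = max{a₀(b,c), C₀E₁, C₀E₂^{1/((2c-1)b-1)}}` (81), starting triples built from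
(82) — so that `v_{e,q}(·,0)` is the same for all `e ∈ 𝓔` and
`‖v_{e,0}‖_{C¹} ≤ C₀ max{a^{b/(1-2α)}, a^bE₁, E₂^{(cb-1/2)/((2c-1)b-1)}}`.

Transcription (file header: units, the restriction `1 < b < b₁(α,c)` forced by the printed proof
§8.2, the `[·]₁` rendering of `C¹` bounds, what is omitted): for `0 < α < 1/5` there are
`c₀, T₀ > 0`, `M ≥ 1`, `η > 0`, `C₀ ≥ 1` such that for every `c > 5/2` there is `b₁ > 1` such
that for every `1 < b < b₁` there is `a₀ > 1` such that for all `1 < E₁ ≤ E₂`, all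
`a ≥ max{a₀, C₀E₁, C₀E₂^{1/((2c-1)b-1)}}` and every admissible family `𝓔`
(`IsEnergyProfileFamily c₀ T₀ E₁ E₂ 𝓔`) there are integer frequencies `Λ q` with
`a^{cb^{q+1}} ≤ Λ q ≤ 2a^{cb^{q+1}}` and maps `e ↦ (v e q, p e q, R e q)_q` such that for each
`e ∈ 𝓔` the sequence is a `CDLDR.IsIterationSequence` with
`L₀ = C₀ max{a^{b/(1-2α)}, a^bE₁, E₂^{(cb-1/2)/((2c-1)b-1)}}`, and `v e₁ q 0 = v e₂ q 0` for
`e₁, e₂ ∈ 𝓔` and all `q`. Named fact, not proved here (the convex-integration construction of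
§§4–8). The hypothesis class is inhabited (`isEnergyProfileFamily_singleton_const`).
[cite: ColomboDelellisDerosa2018, §3 Lemma 3.1, Prop. 3.2 with (26)–(37); §8.3 (81)–(82)] -/
def ColomboDeLellisDeRosa2018_prop32 : Prop :=
  ∀ α : ℝ, 0 < α → α < 1 / 5 →
    ∃ c₀ T₀ M η C₀ : ℝ, 0 < c₀ ∧ 0 < T₀ ∧ 1 ≤ M ∧ 0 < η ∧ 1 ≤ C₀ ∧
      ∀ c : ℝ, 5 / 2 < c →
        ∃ b₁ : ℝ, 1 < b₁ ∧ ∀ b : ℝ, 1 < b → b < b₁ →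
          ∃ a₀ : ℝ, 1 < a₀ ∧
            ∀ (E₁ E₂ a : ℝ) (𝓔 : Set (ℝ → ℝ)), 1 < E₁ → E₁ ≤ E₂ →
              a₀ ≤ a → C₀ * E₁ ≤ a → C₀ * E₂ ^ (1 / ((2 * c - 1) * b - 1)) ≤ a →
              IsEnergyProfileFamily c₀ T₀ E₁ E₂ 𝓔 →
              ∃ (Λ : ℕ → ℕ) (v : (ℝ → ℝ) → ℕ → ℝ → 𝕋³ → ℝ³) (p : (ℝ → ℝ) → ℕ → ℝ → 𝕋³ → ℝ)
                (R : (ℝ → ℝ) → ℕ → ℝ → 𝕋³ → Fin 3 → ℝ³),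
                (∀ q, a ^ (c * b ^ (q + 1)) ≤ Λ q ∧ (Λ q : ℝ) ≤ 2 * a ^ (c * b ^ (q + 1))) ∧
                (∀ e ∈ 𝓔, CDLDR.IsIterationSequence α T₀ M η a b
                  (C₀ * max (a ^ (b / (1 - 2 * α)))
                    (max (a ^ b * E₁) (E₂ ^ ((c * b - 1 / 2) / ((2 * c - 1) * b - 1)))))
                  Λ e (v e) (p e) (R e)) ∧
                (∀ e₁ ∈ 𝓔, ∀ e₂ ∈ 𝓔, ∀ q, v e₁ q 0 = v e₂ q 0)

end NS

end Literature.Analysis.FluidPDE
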